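import Summits.AtomisticToContinuum.HydrodynamicLimit.Theorems.TwoClocksEquilibriumFastWindowLDBirthT12DipoleT1
import HarnessLib

/-!
# T1/T2 in the dipole sector `ℓ = 1`, II: the exact Euler–Volterra defect of the dipole profile and its unified
# bound (helper `t12_dipole_eulerDefect` of the line `birth`, crux `TwoClocks.EquilibriumFastWindowLD`,
# stmt-AtomisticToContinuum-14440; §5 ASSEMBLY, sector `ℓ = 1`, of the registered analytic sub-goal
# `t12_logLinearPreimage_and_dipoleModulus`)

Continuation of `…T12DipoleT1` (notation from there: vector profile `Φ` of the a-priori class `A`, dipole field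
`d = ⟪Φ(‖·‖), ·⟫`, truncation `Φ̃ = 1_{(1,∞)}Φ`, `d = d₁ + d₀`, cube moment `Ψ(s) = ∫₀ˢ t³Φ`, data `G` with
`|G(v)| ≤ 3C_g(1+|v|²)`, `J₆ = ∫(1+|w|)⁶dM`). With `γ(s) := (4/s⁴)Ψ(s) - Φ(s)` one has `Φ = (4/s⁴)Ψ - γ`
identically — the `ℓ = 1` Euler–Volterra equation of `…T12Euler` — and the sector equation prices `γ`:

* `dipoleEulerDefect_eq` — the EXACT form at `v = s e` (`s ≥ 1`):
  `πs²⟪γ(s), e⟫ = [(4π/s²)⟪∫₀ˢt³Φ̃, e⟫ - K₂d₁(v)] - K₂d₀(v) + K₁d(v) + G(v) + (ν(v) - πs)⟪Φ(s), v⟫ + (4π/s²)⟪Ψ(1), e⟫`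
  (normalisation test: for `Φ ≡ b` the field `⟪b, ·⟫` is a collision invariant, `(4/s⁴)∫₀ˢ t³b = b`, `γ = 0`);
* `cubeMoment_one_le`, `dipoleEulerDefect_minor_le` — `‖Ψ(1)‖ ≤ 12A`, and the four minor pieces are `O(πs²)`:
  unit ball `360πAs²` (`abs_gainTerm_le_weight`), (e-K₁) `2πAJ₆s²` (`abs_lossTerm_le_of_quartic`, `d ⊥_M` the
  invariants), data `2πC_g s²`, (e-ν) `72πAs²` (`(ν - πs)s ≤ 3π/2`), `Ψ(1)`-term `48πAs²`;
* the registered **`t12_dipole_eulerDefect`** — if moreover `‖Φ(t)‖ ≤ m W(t)` on `[1, ∞)` for a weight `W` of the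
  class with `n = 2` (lin-log `(1+t)(1+log(1+t))` in round 1, squared-log `(1+log(1+t))²` in round 2), then for
  `s ≥ 1`: **`‖γ(s)‖ ≤ 8448 m W(s)(1+s)/s² + (480 + 2J₆)A + 2C_g`** (the vector (e-K₂)
  `t12_gainTerm_vdipole_sub_cubeMoment` on `Φ̃`, `3·16π·M₆ ≤ 8448π`, tested against the unit vector `γ/‖γ‖`).

The rounds and the packaging for `ψ₀` are in `…T12DipoleT1C` (`t12_dipole_T1`). [folklore] (Grad 1963 §4;
Cercignani–Illner–Pulvirenti 1994 §7.2; plan §5 of the line `birth`.)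
-/

noncomputable section

open MeasureTheory ProbabilityTheory Real Set Filter Metric
open scoped ENNReal BigOperators InnerProductSpace

namespace Summit.AtomisticToContinuum.HydrodynamicLimit.Theorems.ClampedCorrectorBirth

open Literature.Analysis.FluidPDE Literature.MathematicalPhysics.KineticTheory
open Literature.Analysis.UnboundedOperators Literature.Probability.Distributions

/-! ### The exact Euler–Volterra defect of the dipole profile and its unified bound -/

section ProfileB

variable {Φ : ℝ → EuclideanSpace ℝ (Fin 3)} {A : ℝ}
variable {Cg : ℝ} {Gd : EuclideanSpace ℝ (Fin 3) → ℝ}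

/-- **The exact Euler–Volterra form of the dipole sector equation.** At `v = s e` (`s ≥ 1`, `e` unit), with
`Ψ(s) = ∫₀ˢ t³Φ`, the truncation `Φ̃ = 1_{(1,∞)}Φ`, `d = ⟪Φ(‖·‖), ·⟫ = d₁ + d₀` (`gainTerm_dipoleField_split`):
`πs² ⟪(4/s⁴)Ψ(s) - Φ(s), e⟫ = [(4π/s²)⟪∫₀ˢ t³Φ̃, e⟫ - K₂d₁(v)] - K₂d₀(v) + K₁d(v) + G(v) + (ν(v) - πs)⟪Φ(s), v⟫ + (4π/s²)⟪Ψ(1), e⟫`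
(the sector equation `ν⟪Φ(s), v⟫ = K₂d(v) - K₁d(v) - G(v)` and `∫₀ˢ t³Φ̃ = Ψ(s) - Ψ(1)`). [folklore] -/
theorem dipoleEulerDefect_eq (hΦm : Measurable Φ)
    (hΦA : ∀ s, 0 < s → s * ‖Φ s‖ ≤ 3 * A * ((1 + s ^ 2) * (1 + Real.log (1 + s ^ 2))))
    (e : sphere (0 : EuclideanSpace ℝ (Fin 3)) 1) {s : ℝ} (hs : 1 ≤ s)
    (hS : collisionFrequency (s • (e : EuclideanSpace ℝ (Fin 3))) * ⟪Φ s, s • (e : EuclideanSpace ℝ (Fin 3))⟫_ℝ =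
      gainTerm (fun x : EuclideanSpace ℝ (Fin 3) => ⟪Φ ‖x‖, x⟫_ℝ) (s • (e : EuclideanSpace ℝ (Fin 3))) -
        lossTerm (fun x : EuclideanSpace ℝ (Fin 3) => ⟪Φ ‖x‖, x⟫_ℝ) (s • (e : EuclideanSpace ℝ (Fin 3))) -
        Gd (s • (e : EuclideanSpace ℝ (Fin 3)))) :
    π * s ^ 2 * ⟪(4 / s ^ 4) • (∫ t in (0:ℝ)..s, t ^ 3 • Φ t) - Φ s, (e : EuclideanSpace ℝ (Fin 3))⟫_ℝ =
      (4 * π / s ^ 2 * ⟪∫ t in (0:ℝ)..s, t ^ 3 • (Ioi (1:ℝ)).indicator Φ t, (e : EuclideanSpace ℝ (Fin 3))⟫_ℝ -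
          gainTerm (fun x : EuclideanSpace ℝ (Fin 3) => ⟪(Ioi (1:ℝ)).indicator Φ ‖x‖, x⟫_ℝ)
            (s • (e : EuclideanSpace ℝ (Fin 3)))) -
        gainTerm (fun x : EuclideanSpace ℝ (Fin 3) => ⟪Φ ‖x‖, x⟫_ℝ - ⟪(Ioi (1:ℝ)).indicator Φ ‖x‖, x⟫_ℝ)
          (s • (e : EuclideanSpace ℝ (Fin 3))) +
        lossTerm (fun x : EuclideanSpace ℝ (Fin 3) => ⟪Φ ‖x‖, x⟫_ℝ) (s • (e : EuclideanSpace ℝ (Fin 3))) +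
        Gd (s • (e : EuclideanSpace ℝ (Fin 3))) +
        (collisionFrequency (s • (e : EuclideanSpace ℝ (Fin 3))) - π * s) * ⟪Φ s, s • (e : EuclideanSpace ℝ (Fin 3))⟫_ℝ +
        4 * π / s ^ 2 * ⟪∫ t in (0:ℝ)..1, t ^ 3 • Φ t, (e : EuclideanSpace ℝ (Fin 3))⟫_ℝ := by
  rw [(gainTerm_dipoleField_split hΦm hΦA _).1] at hS
  rw [real_inner_smul_right] at hS ⊢
  rw [inner_sub_left, real_inner_smul_left, cubeMoment_truncProfile hΦm hΦA hs, inner_sub_left]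
  have e4 : π * s ^ 2 * (4 / s ^ 4) = 4 * π / s ^ 2 := by
    field_simp
  linear_combination (-1:ℝ) * hS + ⟪∫ t in (0:ℝ)..s, t ^ 3 • Φ t, (e : EuclideanSpace ℝ (Fin 3))⟫_ℝ * e4

/-- The Volterra density `t³Φ(t)` is integrable on `[0, 1]` with `‖∫₀¹ t³Φ‖ ≤ 12A` (`‖t³Φ(t)‖ ≤ 12A` on `(0, 1]`).
[folklore] -/
theorem cubeMoment_one_le (hΦm : Measurable Φ)
    (hΦA : ∀ s, 0 < s → s * ‖Φ s‖ ≤ 3 * A * ((1 + s ^ 2) * (1 + Real.log (1 + s ^ 2)))) :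
    IntervalIntegrable (fun t => t ^ 3 • Φ t) volume 0 1 ∧ ‖∫ t in (0:ℝ)..1, t ^ 3 • Φ t‖ ≤ 12 * A := by
  have h01 := (dipoleField_apriori hΦA).2.2.2.2.2.2
  have hb : ∀ t ∈ uIoc (0:ℝ) 1, ‖t ^ 3 • Φ t‖ ≤ 12 * A := fun t ht => by
    rw [uIoc_of_le zero_le_one] at ht
    exact h01 t ht.1 ht.2
  refine ⟨intervalIntegrable_of_norm_le (by fun_prop) hb, ?_⟩
  have h := intervalIntegral.norm_integral_le_of_norm_le_const hb
  rwa [sub_zero, abs_one, mul_one] at h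

/-- **The minor pieces of the dipole defect** at `v = s e`, `s ≥ 1`, signed as they enter `dipoleEulerDefect_eq`:
`|K₂d₀(v)| ≤ 360πAs²` (unit-ball piece, `abs_gainTerm_le_weight`), `|K₁d(v)| ≤ 2πAJ₆s²` ((e-K₁) on the quartic
class, `d ⊥_M` the invariants), `|G(v)| ≤ 2πC_g s²`, `(ν - πs)⟪Φ(s), v⟫ ≤ 72πAs²` ((e-ν): `(ν - πs)s ≤ 3π/2`),
`(4π/s²)⟪Ψ(1), e⟫ ≤ 48πAs²`; in total `≤ πs²((480 + 2J₆)A + 2C_g)`. [folklore] -/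
theorem dipoleEulerDefect_minor_le (hΦm : Measurable Φ)
    (hΦA : ∀ s, 0 < s → s * ‖Φ s‖ ≤ 3 * A * ((1 + s ^ 2) * (1 + Real.log (1 + s ^ 2))))
    (horth : ∀ φ ∈ collisionInvariants (EuclideanSpace ℝ (Fin 3)),
      maxwellianInner (fun x : EuclideanSpace ℝ (Fin 3) => ⟪Φ ‖x‖, x⟫_ℝ) φ = 0)
    (hCg : 0 ≤ Cg) (hG : ∀ v : EuclideanSpace ℝ (Fin 3), |Gd v| ≤ 3 * Cg * (1 + ‖v‖ ^ 2))
    (e : sphere (0 : EuclideanSpace ℝ (Fin 3)) 1) {s : ℝ} (hs : 1 ≤ s) :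
    -gainTerm (fun x : EuclideanSpace ℝ (Fin 3) => ⟪Φ ‖x‖, x⟫_ℝ - ⟪(Ioi (1:ℝ)).indicator Φ ‖x‖, x⟫_ℝ)
          (s • (e : EuclideanSpace ℝ (Fin 3))) +
        lossTerm (fun x : EuclideanSpace ℝ (Fin 3) => ⟪Φ ‖x‖, x⟫_ℝ) (s • (e : EuclideanSpace ℝ (Fin 3))) +
        Gd (s • (e : EuclideanSpace ℝ (Fin 3))) +
        (collisionFrequency (s • (e : EuclideanSpace ℝ (Fin 3))) - π * s) * ⟪Φ s, s • (e : EuclideanSpace ℝ (Fin 3))⟫_ℝ +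
        4 * π / s ^ 2 * ⟪∫ t in (0:ℝ)..1, t ^ 3 • Φ t, (e : EuclideanSpace ℝ (Fin 3))⟫_ℝ ≤
      π * s ^ 2 * ((480 + 2 * ∫ w, (1 + ‖w‖) ^ 6 ∂stdGaussian (EuclideanSpace ℝ (Fin 3))) * A + 2 * Cg) := by
  obtain ⟨J, hJ0, hJ⟩ : ∃ J : ℝ, 0 ≤ J ∧ (∫ w, (1 + ‖w‖) ^ 6 ∂stdGaussian (EuclideanSpace ℝ (Fin 3))) = J :=
    ⟨_, integral_nonneg fun w => by positivity, rfl⟩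
  rw [hJ]
  obtain ⟨hA, hdQ, hd4, -⟩ := dipoleField_apriori hΦA
  have hs0 : 0 < s := by linarith
  have hs2 : (1:ℝ) ≤ s ^ 2 := by nlinarith
  set v : EuclideanSpace ℝ (Fin 3) := s • (e : EuclideanSpace ℝ (Fin 3)) with hv
  have hvn : ‖v‖ = s := by rw [hv, norm_smul_sphere, abs_of_pos hs0]
  have hv0 : v ≠ 0 := by rw [← norm_ne_zero_iff, hvn]; exact hs0.ne'
  -- (i) the unit-ball piece, (ii) the loss term, (iii) the data
  have t1 := (neg_le_abs _).trans (gainTerm_dipoleField_split hΦm hΦA v).2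
  have t2 := (le_abs_self _).trans (abs_lossTerm_le_of_quartic (u := fun x : EuclideanSpace ℝ (Fin 3) => ⟪Φ ‖x‖, x⟫_ℝ)
    ((hΦm.comp measurable_norm).inner measurable_id) hd4 horth hv0)
  have t3 := (le_abs_self _).trans (hG v)
  rw [hvn] at t1 t3
  rw [hvn, hJ] at t2
  have k1 : 12 * A * π * (4 / 3 * s ^ 2 + 14 * (1 + s)) ≤ 360 * π * A * s ^ 2 := by
    have : 4 / 3 * s ^ 2 + 14 * (1 + s) ≤ 30 * s ^ 2 := by nlinarith
    nlinarith [mul_nonneg (mul_nonneg hA pi_pos.le) (by linarith : (0:ℝ) ≤ 30 * s ^ 2 - (4 / 3 * s ^ 2 + 14 * (1 + s)))]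
  have k2 : π / (2 * s) * (3 * A * J) ≤ 2 * π * A * J * s ^ 2 := by
    rw [div_mul_eq_mul_div, div_le_iff₀ (by positivity)]
    nlinarith [mul_nonneg (mul_nonneg pi_pos.le (mul_nonneg hA hJ0)) (by nlinarith : (0:ℝ) ≤ 4 * s ^ 3 - 3)]
  have k3 : 3 * Cg * (1 + s ^ 2) ≤ 2 * π * Cg * s ^ 2 := by
    nlinarith [mul_nonneg (sub_nonneg.2 Real.pi_gt_three.le) (mul_nonneg hCg (sq_nonneg s)),
      mul_nonneg hCg (sub_nonneg.2 hs2)]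
  -- (iv) (e-ν)
  have hν0 : 0 ≤ collisionFrequency v - π * s := by
    have h := pi_mul_norm_le_collisionFrequency v
    rw [hvn] at h
    linarith
  have hν1 : (collisionFrequency v - π * s) * s ≤ 3 * π / 2 := by
    have h := t12_collisionFrequency_le_pi v
    rw [hvn] at h
    nlinarith
  have t4 : (collisionFrequency v - π * s) * ⟪Φ s, v⟫_ℝ ≤ 72 * π * A * s ^ 2 := by
    have h1 : ⟪Φ s, v⟫_ℝ ≤ 3 * A * (16 * s ^ 3) := by
      have h := hdQ v
      rw [hvn] at h
      refine ((le_abs_self _).trans h).trans (mul_le_mul_of_nonneg_left ?_ (by positivity))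
      nlinarith [quadLog_le_mul_linLog hs, linLog_le_mul_linear hs]
    calc (collisionFrequency v - π * s) * ⟪Φ s, v⟫_ℝ
        ≤ (collisionFrequency v - π * s) * (3 * A * (16 * s ^ 3)) := mul_le_mul_of_nonneg_left h1 hν0
      _ = 48 * A * s ^ 2 * ((collisionFrequency v - π * s) * s) := by ring
      _ ≤ 48 * A * s ^ 2 * (3 * π / 2) := mul_le_mul_of_nonneg_left hν1 (by positivity)
      _ = 72 * π * A * s ^ 2 := by ring
  -- (v) the small-speed moment `Ψ(1)`
  have t5 : 4 * π / s ^ 2 * ⟪∫ t in (0:ℝ)..1, t ^ 3 • Φ t, (e : EuclideanSpace ℝ (Fin 3))⟫_ℝ ≤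
      48 * π * A * s ^ 2 := by
    have h1 : ⟪∫ t in (0:ℝ)..1, t ^ 3 • Φ t, (e : EuclideanSpace ℝ (Fin 3))⟫_ℝ ≤ 12 * A := by
      refine (le_abs_self _).trans ((abs_real_inner_le_norm _ _).trans ?_)
      rw [norm_eq_of_mem_sphere e, mul_one]
      exact (cubeMoment_one_le hΦm hΦA).2
    have h2 : 4 * π / s ^ 2 ≤ 4 * π * s ^ 2 := by
      rw [div_le_iff₀ (by positivity)]
      nlinarith [pi_pos, one_le_pow₀ (M₀ := ℝ) (n := 2) hs2]
    calc 4 * π / s ^ 2 * ⟪∫ t in (0:ℝ)..1, t ^ 3 • Φ t, (e : EuclideanSpace ℝ (Fin 3))⟫_ℝ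
        ≤ 4 * π / s ^ 2 * (12 * A) := mul_le_mul_of_nonneg_left h1 (by positivity)
      _ ≤ 4 * π * s ^ 2 * (12 * A) := mul_le_mul_of_nonneg_right h2 (by positivity)
      _ = 48 * π * A * s ^ 2 := by ring
  have hR : π * s ^ 2 * ((480 + 2 * J) * A + 2 * Cg) = 360 * π * A * s ^ 2 + 2 * π * A * J * s ^ 2 +
      2 * π * Cg * s ^ 2 + 72 * π * A * s ^ 2 + 48 * π * A * s ^ 2 := by ring
  rw [hR]
  linarith [t1, k1, t2, k2, t3, k3, t4, t5]

/-- **Registered helper `t12_dipole_eulerDefect` — the Euler–Volterra defect of the dipole sector, unified bound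
(the round lemma of the `ℓ = 1` bootstrap).** Let `Φ` be a measurable vector profile of
the class `s‖Φ(s)‖ ≤ 3A(1+s²)(1+log(1+s²))`, whose dipole field `d = ⟪Φ(‖·‖), ·⟫` is `M`-orthogonal to the
collision invariants and solves the `ℓ = 1` sector equation `ν d = K₂d - K₁d - G` pointwise with data
`|G(v)| ≤ 3C_g(1+|v|²)`; suppose moreover `‖Φ(t)‖ ≤ m W(t)` on `[1, ∞)` for a weight `W` of the class with `n = 2`
(`W ≥ 1` nondecreasing, `W(s+t) ≤ W(s)(1+t)²`; `m ≥ 0`). Then for `s ≥ 1`, with `Ψ(s) = ∫₀ˢ t³Φ`: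
`‖(4/s⁴)Ψ(s) - Φ(s)‖ ≤ 8448 m W(s)(1+s)/s² + (480 + 2J₆)A + 2C_g`, `J₆ = ∫(1+|w|)⁶dM` — the exact form
`dipoleEulerDefect_eq` tested against the unit vector `e = γ/‖γ‖`, the vector (e-K₂) comparison
`t12_gainTerm_vdipole_sub_cubeMoment` on the truncation `1_{(1,∞)}Φ` (`3·16π·176 = 8448π`), and
`dipoleEulerDefect_minor_le`. [folklore] -/
theorem t12_dipole_eulerDefect : ∀ (Φ : ℝ → EuclideanSpace ℝ (Fin 3)) (G : EuclideanSpace ℝ (Fin 3) → ℝ) (W : ℝ → ℝ) (A Cg m : ℝ), Measurable Φ → (∀ s : ℝ, 0 < s → s * ‖Φ s‖ ≤ 3 * A * ((1 + s ^ 2) * (1 + Real.log (1 + s ^ 2)))) → (∀ φ ∈ Literature.Analysis.UnboundedOperators.collisionInvariants (EuclideanSpace ℝ (Fin 3)), Literature.Analysis.UnboundedOperators.maxwellianInner (fun x : EuclideanSpace ℝ (Fin 3) => inner ℝ (Φ ‖x‖) x) φ = 0) → (∀ a b : ℝ, 0 ≤ a → a ≤ b → W a ≤ W b) → (∀ a :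 ℝ, 0 ≤ a → 1 ≤ W a) → (∀ s t : ℝ, 0 ≤ s → 0 ≤ t → W (s + t) ≤ W s * (1 + t) ^ 2) → 0 ≤ m → (∀ t : ℝ, 1 ≤ t → ‖Φ t‖ ≤ m * W t) → 0 ≤ Cg → (∀ v : EuclideanSpace ℝ (Fin 3), |G v| ≤ 3 * Cg * (1 + ‖v‖ ^ 2)) → (∀ v : EuclideanSpace ℝ (Fin 3), Literature.Analysis.UnboundedOperators.collisionFrequency v * inner ℝ (Φ ‖v‖) v = Summit.AtomisticToContinuum.HydrodynamicLimit.Theorems.ClampedCorrectorBirth.gainTerm (fun x : EuclideanSpace ℝ (Fin 3) => inner ℝ (Φ ‖x‖) x) v - Summit.AtomisticToContinuum.HydrodynamicLimit.Theorems.ClampedCorrectorBirth.lossTerm (fun x : EuclideanSpace ℝ (Fin 3) => inner ℝ (Φ ‖x‖) x) v - G v) → ∀ s : ℝ, 1 ≤ s → ‖(4 / s ^ 4) • (∫ t in (0:ℝ)..s, t ^ 3 • Φ t) - Φ s‖ ≤ 8448 * m * (W s * (1 + s) / s ^ 2) + ((480 + 2 * ∫ w, (1 + ‖w‖) ^ 6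 ∂ProbabilityTheory.stdGaussian (EuclideanSpace ℝ (Fin 3))) * A + 2 * Cg) := by
  intro Φ Gd W A Cg m hΦm hΦA horth hWa hWb hWc hm hΦW hCg hG hS s hs
  have hW : (∀ a b : ℝ, 0 ≤ a → a ≤ b → W a ≤ W b) ∧ (∀ a : ℝ, 0 ≤ a → 1 ≤ W a) ∧
      ∀ s t : ℝ, 0 ≤ s → 0 ≤ t → W (s + t) ≤ W s * (1 + t) ^ 2 := ⟨hWa, hWb, hWc⟩
  obtain ⟨J, hJ0, hJ⟩ : ∃ J : ℝ, 0 ≤ J ∧ (∫ w, (1 + ‖w‖) ^ 6 ∂stdGaussian (EuclideanSpace ℝ (Fin 3))) = J :=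
    ⟨_, integral_nonneg fun w => by positivity, rfl⟩
  have hminor := fun e => dipoleEulerDefect_minor_le (Gd := Gd) hΦm hΦA horth hCg hG e hs
  rw [hJ] at hminor ⊢
  have hA := (dipoleField_apriori hΦA).1
  have hs0 : 0 < s := by linarith
  have hW1 : 1 ≤ W s := hW.2.1 s hs0.le
  set X : EuclideanSpace ℝ (Fin 3) := (4 / s ^ 4) • (∫ t in (0:ℝ)..s, t ^ 3 • Φ t) - Φ s with hX
  set B : ℝ := 8448 * m * (W s * (1 + s) / s ^ 2) + ((480 + 2 * J) * A + 2 * Cg) with hB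
  have hB0 : 0 ≤ B := by positivity
  -- reduction to a unit vector
  suffices key : ∀ e : sphere (0 : EuclideanSpace ℝ (Fin 3)) 1,
      π * s ^ 2 * ⟪X, (e : EuclideanSpace ℝ (Fin 3))⟫_ℝ ≤ π * s ^ 2 * B by
    by_cases hX0 : X = 0
    · rw [hX0, norm_zero]; exact hB0
    have hXn : 0 < ‖X‖ := norm_pos_iff.2 hX0
    let e₀ : sphere (0 : EuclideanSpace ℝ (Fin 3)) 1 :=
      ⟨‖X‖⁻¹ • X, by rw [mem_sphere_zero_iff_norm, norm_smul, norm_inv, norm_norm, inv_mul_cancel₀ hXn.ne']⟩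
    have he₀ : ⟪X, (e₀ : EuclideanSpace ℝ (Fin 3))⟫_ℝ = ‖X‖ := by
      show ⟪X, ‖X‖⁻¹ • X⟫_ℝ = ‖X‖
      rw [real_inner_smul_right, real_inner_self_eq_norm_sq]
      field_simp
    have h := key e₀
    rw [he₀] at h
    exact le_of_mul_le_mul_left h (by positivity)
  intro e
  have hs' : ‖s • (e : EuclideanSpace ℝ (Fin 3))‖ = s := by rw [norm_smul_sphere, abs_of_pos hs0]
  have hSe := hS (s • (e : EuclideanSpace ℝ (Fin 3)))
  rw [hs'] at hSe
  have hid := dipoleEulerDefect_eq hΦm hΦA e hs hSe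
  have hΦtW : ∀ t, 0 ≤ t → ‖(Ioi (1:ℝ)).indicator Φ t‖ ≤ m * W t :=
    norm_truncProfile_le hm (fun t ht => zero_le_one.trans (hW.2.1 t ht)) hΦW
  have tA : |gainTerm (fun x : EuclideanSpace ℝ (Fin 3) => ⟪(Ioi (1:ℝ)).indicator Φ ‖x‖, x⟫_ℝ)
        (s • (e : EuclideanSpace ℝ (Fin 3))) -
      4 * π / s ^ 2 * ⟪∫ r in (0:ℝ)..s, r ^ 3 • (Ioi (1:ℝ)).indicator Φ r, (e : EuclideanSpace ℝ (Fin 3))⟫_ℝ| ≤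
      8448 * π * m * (W s * (1 + s)) := by
    have h := t12_gainTerm_vdipole_sub_cubeMoment W m 2 _ hWa hWb hWc (hΦm.indicator measurableSet_Ioi) hΦtW e s hs0
    refine h.trans ?_
    calc 3 * (16 * π * m * W s * (1 + s) * ∫ t, (1 + |t|) ^ (2 + 4) ∂gaussianReal 0 1)
        ≤ 3 * (16 * π * m * W s * (1 + s) * 176) := by
          gcongr
          exact integral_one_add_abs_pow_le.2
      _ = 8448 * π * m * (W s * (1 + s)) := by ring
  have hBeq : π * s ^ 2 * B = 8448 * π * m * (W s * (1 + s)) + π * s ^ 2 * ((480 + 2 * J) * A + 2 * Cg) := by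
    rw [hB]
    field_simp
  rw [hX, hid, hBeq]
  linarith [hminor e, (le_abs_self _).trans ((abs_sub_comm _ _).trans_le tA)]

end ProfileB

end Summit.AtomisticToContinuum.HydrodynamicLimit.Theorems.ClampedCorrectorBirth

end
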